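import Mathlib.RingTheory.KrullDimension.NonZeroDivisors
import Literature.ModelTheory.Zilber.EAC
import Literature.NumberTheory.Transcendental.ExpDominantSolvabilityProofs
import HarnessLib

/-!
# Zilber's Exponential-Algebraic Closedness for `ℂ_exp`: the known cells of the case ladder, proved

Discharges, over the vocabulary of `EAC.lean` (`ECCell n d` = EAC restricted to varieties whose
additive projection has `d`-dimensional Zariski closure), every cell of the ladder that the refereed
literature settles, from the tree THEOREM
`Literature.NumberTheory.Transcendental.BrownawellMasser2017_dominantProjection_holds`
(Brownawell–Masser, JLMS 95 (2017) Prop. 2, Masser/DFT Newton argument, fully proved in the tree) and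
the one NAMED FACT `mantovaMasser2024_thm_1_1` (Mantova–Masser, PLMS 129 (2024) Thm. 1.1):

* `ecCell_zero_right` — the cell `d = 0` is VACUOUS for `n ≥ 1`: the closure of `π(V)` is irreducible
  (`isPrime_vanishingIdeal_projAdd`), so dimension `0` makes it a point
  (`exists_forall_eq_of_zariskiDim_eq_zero`, Nullstellensatz) and `x₁` is constant on `V`, against
  additive freeness (Mantova–Masser 2024 §1: "if this dimension is 0, then `π(V)` is a single point");
* `ecCell_self` — the cell `d = n` IS Brownawell–Masser 2017 Prop. 2: a subset of `ℂⁿ` of Zariski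
  dimension `n` has vanishing ideal `⊥` (`vanishingIdeal_eq_bot_of_zariskiDim_eq`), i.e. the additive
  projection is dominant (`hasDominantAddProjection_iff_vanishingIdeal_eq_bot`);
* `ecCell_one_right_of_mantovaMasser` — the cell `d = 1` is Mantova–Masser 2024 Thm. 1.1 (weakening:
  `dim V = n` gives `dim V ≥ n`; rotundity and multiplicative freeness are dropped);
* `ecCell_zero_left`, `ecCell_one_left` — `n = 0` (trivial) and Marker's rung `n = 1` (J. Symb. Logic 71
  (2006) Cor. 2.4 in cell form: `d ∈ {0, 1}`), unconditionally;
* `aslanyanGallinaro2024_ec_le_two_of_mantovaMasser` — the printed corollary "EC holds for all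
  subvarieties of `ℂ² × (ℂˣ)²`" (Aslanyan–Gallinaro arXiv:2409.12860 §3.4; Mantova–Masser 2024 Thm. 1.2)
  DERIVED exactly as printed, from Brownawell–Masser and Mantova–Masser Thm. 1.1 by the trichotomy
  `d ∈ {0, 1, 2}` — so the named fact `aslanyanGallinaro2024_ec_le_two` of `EAC.lean` is reduced to
  `mantovaMasser2024_thm_1_1`;
* `isExpAlgClosed_complex_iff_open_regime` — **granted Mantova–Masser 2024 Thm. 1.1, EAC for `ℂ_exp` is
  EQUIVALENT to its open regime** `n ≥ 3`, `2 ≤ d ≤ n − 1` (the hypothesis `hopen` of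
  `isExpAlgClosed_complex_of_ladder`), and, granted also Gallinaro 2023 Thm. 8.8, to the NON-SPLIT open
  regime (`isExpAlgClosed_complex_iff_open_regime_nonsplit`); in `ℂ³ × (ℂˣ)³` everything reduces to
  the single cell `ECCell 3 2` (`forall_ecCell_three_iff`) — the literature's own "simplest open case"
  (Mantova–Masser 2024 §1 p. 5).

Nothing open is asserted: `ECCell 3 2` and the open regime appear only as hypotheses / sides of an
`↔`. Honest framing: these are rungs of EAC; no implication between EAC and Schanuel's conjecture is
known or expected (Aslanyan–Gallinaro 2024 §3.5); see `Placement.lean`.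

Not here: the discharge of `aslanyanKirbyMantova2023_thm_1_5` (arbitrary algebraic `V` with dominant
projection, any dimension) from the `dim V = n` theorem — it needs a reduction of an irreducible
component of dimension `n' > n` to dimension `n'`-form data (e.g. the coordinate-doubling
`(x, y) ↦ (x, y_I, y, y_I)` with `x ∪ y_I` a transcendence basis of `ℂ(V)`), recorded as a target in
the cell's LADDER.md; and `marker2006_cor_2_4` in its printed "infinitely many zeros" form.

## References
* W. D. Brownawell, D. W. Masser, *Zero estimates with moving targets*, JLMS 95 (2017) 441–454, Prop. 2.
* V. Mantova, D. Masser, *Polynomial-exponential equations — some new cases of solvability*, PLMS 129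
  (2024) e12627 (arXiv:2303.05592), Thm. 1.1, Thm. 1.2, §1.
* V. Aslanyan, F. Gallinaro, arXiv:2409.12860 (2024), §3.4.
* F. Gallinaro, Selecta Math. 29 (2023) (arXiv:2203.13767), Thm. 8.8.
* D. Marker, J. Symb. Logic 71 (2006), Cor. 2.4.
-/

noncomputable section

open MvPolynomial

namespace Literature.ModelTheory.Zilber

open Literature.NumberTheory.Transcendental

variable {n : ℕ}

/-! ### Vanishing ideals of `V = W ∩ Gⁿ` and of its additive projection -/

/-- A Zariski closed set is the zero locus of its own vanishing ideal. [folklore] -/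
theorem eq_zeroLocus_vanishingIdeal_of_isZariskiClosed {K : Type*} [Field K] {ι : Type*}
    {W : Set (ι → K)} (hW : IsZariskiClosed K W) : W = zeroLocus K (vanishingIdeal K W) := by
  obtain ⟨I, hWI⟩ := hW
  refine le_antisymm (zeroLocus_vanishingIdeal_le W) ?_
  rw [hWI]
  exact zeroLocus_anti_mono (le_vanishingIdeal_zeroLocus I)

/-- `V = W ∩ Gⁿ` is Zariski dense in the irreducible `W` when nonempty: the polynomials vanishing on
`W ∩ (ℂⁿ × (ℂˣ)ⁿ)` are exactly those vanishing on `W`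
(`vanishingIdeal_zeroLocus_inter_torusLocus` for `W = Z(I(W))`). [folklore] -/
theorem vanishingIdeal_inter_torusLocus {W : Set (Fin n ⊕ Fin n → ℂ)} (hW : IsIrreducibleClosed ℂ W)
    (hne : (W ∩ torusLocus ℂ n).Nonempty) :
    vanishingIdeal ℂ (W ∩ torusLocus ℂ n) = vanishingIdeal ℂ W := by
  haveI : (vanishingIdeal ℂ W).IsPrime := hW.2
  have hWP : W = zeroLocus ℂ (vanishingIdeal ℂ W) :=
    eq_zeroLocus_vanishingIdeal_of_isZariskiClosed hW.1
  have hne' : (zeroLocus ℂ (vanishingIdeal ℂ W) ∩ torusLocus ℂ n).Nonempty := by rwa [← hWP]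
  have key := vanishingIdeal_zeroLocus_inter_torusLocus (vanishingIdeal ℂ W) hne'
  rwa [← hWP] at key

/-- A polynomial in the additive coordinates vanishes on `π(V)` iff, read as a polynomial in all
coordinates, it vanishes on `V`. [folklore] -/
theorem mem_vanishingIdeal_image_projAdd_iff {K : Type*} [Field K] (V : Set (Fin n ⊕ Fin n → K))
    (p : MvPolynomial (Fin n) K) :
    p ∈ vanishingIdeal K (projAdd '' V) ↔ rename Sum.inl p ∈ vanishingIdeal K V := by
  simp only [mem_vanishingIdeal_iff, Set.forall_mem_image, aeval_rename]
  rfl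

/-- The vanishing ideal of the additive projection `π(V)` is the contraction of the vanishing ideal
of `V` along `ℂ[x] ↪ ℂ[x, y]`. [folklore] -/
theorem vanishingIdeal_image_projAdd {K : Type*} [Field K] (V : Set (Fin n ⊕ Fin n → K)) :
    vanishingIdeal K (projAdd '' V) =
      (vanishingIdeal K V).comap (rename (Sum.inl : Fin n → Fin n ⊕ Fin n)) := by
  ext p
  rw [mem_vanishingIdeal_image_projAdd_iff, Ideal.mem_comap]

/-- The Zariski closure of the additive projection of `V = W ∩ Gⁿ` (`W` irreducible, `V ≠ ∅`) is
irreducible: its vanishing ideal is prime (contraction of the prime `I(W)`). [folklore] -/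
theorem isPrime_vanishingIdeal_projAdd {W : Set (Fin n ⊕ Fin n → ℂ)} (hW : IsIrreducibleClosed ℂ W)
    (hne : (W ∩ torusLocus ℂ n).Nonempty) :
    (vanishingIdeal ℂ (projAdd '' (W ∩ torusLocus ℂ n))).IsPrime := by
  rw [vanishingIdeal_image_projAdd, vanishingIdeal_inter_torusLocus hW hne]
  haveI : (vanishingIdeal ℂ W).IsPrime := hW.2
  infer_instance

/-! ### Dimension `0` and dimension `n` subsets of `ℂⁿ` -/

/-- An irreducible subset of `ℂⁿ` (prime vanishing ideal) of Zariski dimension `0` is supported at a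
single point: a prime `P ⊆ ℂ[x₁, …, xₙ]` with `dim ℂ[x]/P = 0` is maximal, hence `P = 𝔪ₐ` by the
Nullstellensatz, and every point of the set is `a`. [folklore] -/
theorem exists_forall_eq_of_zariskiDim_eq_zero {S : Set (Fin n → ℂ)}
    (hprime : (vanishingIdeal ℂ S).IsPrime) (h0 : zariskiDim ℂ S = 0) :
    ∃ a : Fin n → ℂ, ∀ x ∈ S, x = a := by
  set I : Ideal (MvPolynomial (Fin n) ℂ) := vanishingIdeal ℂ S with hI
  haveI := hprime
  haveI : Ring.KrullDimLE 0 (MvPolynomial (Fin n) ℂ ⧸ I) := by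
    rw [Ring.krullDimLE_iff]
    have h0' : ringKrullDim (MvPolynomial (Fin n) ℂ ⧸ I) = 0 := h0
    rw [Nat.cast_zero]
    exact h0'.le
  haveI : IsDomain (MvPolynomial (Fin n) ℂ ⧸ I) := Ideal.Quotient.isDomain I
  haveI hbot : (⊥ : Ideal (MvPolynomial (Fin n) ℂ ⧸ I)).IsMaximal :=
    Ideal.IsPrime.isMaximal' Ideal.isPrime_bot
  have hmax : I.IsMaximal := by
    have h := Ideal.comap_isMaximal_of_surjective (Ideal.Quotient.mk I) Ideal.Quotient.mk_surjective
      (K := ⊥)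
    rwa [← RingHom.ker_eq_comap_bot, Ideal.mk_ker] at h
  obtain ⟨a, ha⟩ := isMaximal_iff_eq_vanishingIdeal_singleton.mp hmax
  refine ⟨a, fun x hx => ?_⟩
  funext i
  have hmem : (X i - C (a i) : MvPolynomial (Fin n) ℂ) ∈ I := by
    rw [ha, mem_vanishingIdeal_singleton_iff]
    simp
  have := (mem_vanishingIdeal_iff.mp hmem) x hx
  simpa [sub_eq_zero] using this

/-- A subset of `ℂⁿ` of Zariski dimension `n` is Zariski dense: its vanishing ideal is `⊥` (a nonzero
`r ∈ I(S)` would give `dim ℂ[x]/I(S) + 1 ≤ dim ℂ[x]/(r) + 1 ≤ dim ℂ[x] = n`). [folklore] -/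
theorem vanishingIdeal_eq_bot_of_zariskiDim_eq {S : Set (Fin n → ℂ)} (h : zariskiDim ℂ S = n) :
    vanishingIdeal ℂ S = ⊥ := by
  by_contra hne
  obtain ⟨r, hrI, hr0⟩ := Submodule.exists_mem_ne_zero_of_ne_bot hne
  have hR : ringKrullDim (MvPolynomial (Fin n) ℂ) = n := by
    rw [MvPolynomial.ringKrullDim_of_isNoetherianRing, ringKrullDim_eq_zero_of_field]
    simp
  have h1 : ringKrullDim (MvPolynomial (Fin n) ℂ ⧸ Ideal.span {r}) + 1 ≤ n := by
    rw [← hR]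
    exact ringKrullDim_quotient_succ_le_of_nonZeroDivisor (mem_nonZeroDivisors_of_ne_zero hr0)
  have h2 : zariskiDim ℂ S ≤ ringKrullDim (MvPolynomial (Fin n) ℂ ⧸ Ideal.span {r}) := by
    unfold zariskiDim
    refine ringKrullDim_le_of_surjective (Ideal.Quotient.factor ?_) (Ideal.Quotient.factor_surjective _)
    exact (Ideal.span_singleton_le_iff_mem _).mpr hrI
  rw [h] at h2
  have h3 : (n : WithBot ℕ∞) + 1 ≤ n := (add_le_add h2 le_rfl).trans h1
  have h4 : ((n + 1 : ℕ) : WithBot ℕ∞) ≤ ((n : ℕ) : WithBot ℕ∞) := by exact_mod_cast h3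
  have h5 : n + 1 ≤ n := by exact_mod_cast h4
  omega

/-- The projection dimension `d` of a nonempty `V ⊆ ℂⁿ × (ℂˣ)ⁿ` is at most `n`. [folklore] -/
theorem le_of_addProjDim_eq {W : Set (Fin n ⊕ Fin n → ℂ)} (hne : (W ∩ torusLocus ℂ n).Nonempty)
    {d : ℕ} (hd : addProjDim ℂ n W = d) : d ≤ n := by
  obtain ⟨d', hd'n, hd'⟩ := exists_nat_zariskiDim_eq (K := ℂ) (hne.image projAdd)
  have h1 : (d : WithBot ℕ∞) = d' := by rw [← hd', ← hd]; rfl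
  have hdd : d = d' := by exact_mod_cast h1
  omega

/-! ### The known cells -/

/-- **Cell `d = 0` is vacuous** (`n ≥ 1`): an additively free `V` cannot have `0`-dimensional additive
projection — `π(V)` would be a single point, making `x₁` constant on `V` (Mantova–Masser 2024 §1: "if
this dimension is 0, then `π(V)` is a single point"). [cite: MantovaMasser2023, §1] -/
theorem ecCell_zero_right (hn : 1 ≤ n) : ECCell n 0 := by
  intro W hW hne _ hadd _ _ hd
  exfalso
  have hd0 : zariskiDim ℂ (projAdd '' (W ∩ torusLocus ℂ n)) = 0 := by
    have := hd
    unfold addProjDim at this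
    simpa using this
  obtain ⟨a, ha⟩ :=
    exists_forall_eq_of_zariskiDim_eq_zero (isPrime_vanishingIdeal_projAdd hW hne) hd0
  set i₀ : Fin n := ⟨0, hn⟩
  refine hadd (Pi.single i₀ 1) (fun h => by simpa using congrFun h i₀) ⟨a i₀, fun z hz => ?_⟩
  have hz' : projAdd z = a := ha (projAdd z) ⟨z, hz, rfl⟩
  have hzi : z (Sum.inl i₀) = a i₀ := by
    have := congrFun hz' i₀
    simpa using this
  simp only [Pi.single_apply, Int.cast_ite, Int.cast_one, Int.cast_zero, ite_mul, one_mul, zero_mul,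
    Finset.sum_ite_eq', Finset.mem_univ, if_true]
  exact hzi

/-- **Cell `d = n` is Brownawell–Masser 2017 Prop. 2** (tree theorem
`BrownawellMasser2017_dominantProjection_holds`): full-dimensional additive projection means dominant
additive projection. Rotundity and freeness are not used. [cite: BrownawellMasser2017, Prop. 2 (p. 448)] -/
theorem ecCell_self (n : ℕ) : ECCell n n := by
  intro W hW _ _ _ _ hdim hproj
  refine BrownawellMasser2017_dominantProjection_holds n W hW hdim ?_
  rw [hasDominantAddProjection_iff_vanishingIdeal_eq_bot]
  exact vanishingIdeal_eq_bot_of_zariskiDim_eq hproj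

/-- **Cell `d = 1` is Mantova–Masser 2024 Thm. 1.1** (granted as the named fact
`mantovaMasser2024_thm_1_1`): `dim V = n ≥ n`, the closure of `π(V)` is a curve, `V` additively free;
the cell's rotundity and multiplicative freeness are simply dropped. [cite: MantovaMasser2023, Thm. 1.1] -/
theorem ecCell_one_right_of_mantovaMasser (h : mantovaMasser2024_thm_1_1) (n : ℕ) : ECCell n 1 := by
  intro W hW hne _ hadd _ hdim hd
  exact h n W hW hne hdim.symm.le (by simpa using hd) hadd

/-- The degenerate cells `n = 0`: `G⁰` is a point and the graph of `exp` is everything. [folklore] -/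
theorem ecCell_zero_left (d : ℕ) : ECCell 0 d := by
  intro W _ hne _ _ _ _ _
  obtain ⟨z, hzW, -⟩ := hne
  exact ⟨z, hzW, fun i => i.elim0⟩

/-- **Marker's rung `n = 1` in cell form, unconditionally** (Marker, J. Symb. Logic 71 (2006) Cor. 2.4;
Aslanyan–Gallinaro 2024 Thm. 3.7): for a free curve `V ⊆ ℂ × ℂˣ` the projection dimension is `0`
(excluded by freeness, `ecCell_zero_right`) or `1` (Brownawell–Masser, `ecCell_self`). (The printed
"infinitely many zeros" form `marker2006_cor_2_4` is not discharged here.) [cite: Marker2006Remark, Cor. 2.4] -/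
theorem ecCell_one_left (d : ℕ) : ECCell 1 d := by
  intro W hW hne hrot hadd hmul hdim hd
  have hdn : d ≤ 1 := le_of_addProjDim_eq hne hd
  interval_cases d
  · exact ecCell_zero_right le_rfl W hW hne hrot hadd hmul hdim hd
  · exact ecCell_self 1 W hW hne hrot hadd hmul hdim hd

/-- **Aslanyan–Gallinaro 2024 §3.4 derived as printed**: Brownawell–Masser (cell `d = 2`, tree theorem)
and Mantova–Masser 2024 Thm. 1.1 (cell `d = 1`, named fact) "together imply [Exponential Closedness]
for all subvarieties of `ℂ² × (ℂˣ)²`" — with `d = 0` excluded by freeness and `n ≤ 1` by Marker's rung.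
Reduces the named fact `aslanyanGallinaro2024_ec_le_two` to `mantovaMasser2024_thm_1_1`.
[cite: AslanyanGallinaro2024, §3.4 (p. 14)] -/
theorem aslanyanGallinaro2024_ec_le_two_of_mantovaMasser (h : mantovaMasser2024_thm_1_1) :
    aslanyanGallinaro2024_ec_le_two := by
  intro n d hn W hW hne hrot hadd hmul hdim hd
  have hdn : d ≤ n := le_of_addProjDim_eq hne hd
  interval_cases n
  · exact ecCell_zero_left d W hW hne hrot hadd hmul hdim hd
  · exact ecCell_one_left d W hW hne hrot hadd hmul hdim hd
  · interval_cases d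
    · exact ecCell_zero_right (by norm_num) W hW hne hrot hadd hmul hdim hd
    · exact ecCell_one_right_of_mantovaMasser h 2 W hW hne hrot hadd hmul hdim hd
    · exact ecCell_self 2 W hW hne hrot hadd hmul hdim hd

/-! ### What exactly remains open -/

/-- **EAC for `ℂ_exp` ⟺ its open regime, granted Mantova–Masser 2024 Thm. 1.1.** With the cells
`d = 0` (vacuous), `d = 1` (Mantova–Masser), `d = n` (Brownawell–Masser, proved) and `n ≤ 2` settled,
`IsExpAlgClosed ℂ` is equivalent to the conjunction of the cells `n ≥ 3`, `2 ≤ d ≤ n − 1` — exactly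
Mantova–Masser's "π(V) of other dimensions" (PLMS 2024 §1 "Further remarks"), an OPEN statement used
here only as one side of the equivalence. [cite: MantovaMasser2023, §1 Further remarks] -/
theorem isExpAlgClosed_complex_iff_open_regime (h : mantovaMasser2024_thm_1_1) :
    IsExpAlgClosed ℂ ↔ ∀ n d : ℕ, 3 ≤ n → 2 ≤ d → d + 1 ≤ n → ECCell n d := by
  constructor
  · intro hE n d _ _ _
    exact (isExpAlgClosed_complex_iff_forall_ecCell.mp hE) n d
  · intro hopen
    exact isExpAlgClosed_complex_of_ladder (fun n hn => ecCell_zero_right hn)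
      (ecCell_one_right_of_mantovaMasser h) ecCell_self
      (aslanyanGallinaro2024_ec_le_two_of_mantovaMasser h) hopen

/-- The same with Gallinaro 2023 Thm. 8.8 granted as well: EAC for `ℂ_exp` is equivalent to the
NON-SPLIT open regime (`ECCellNonsplit`: `W` not of the form `L × Z`, `L` linear), `n ≥ 3`,
`2 ≤ d ≤ n − 1`. [cite: Gallinaro2022, Thm. 8.8] -/
theorem isExpAlgClosed_complex_iff_open_regime_nonsplit (h : mantovaMasser2024_thm_1_1)
    (hG : gallinaro2023_thm_8_8) :
    IsExpAlgClosed ℂ ↔ ∀ n d : ℕ, 3 ≤ n → 2 ≤ d → d + 1 ≤ n → ECCellNonsplit n d := by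
  rw [isExpAlgClosed_complex_iff_open_regime h]
  constructor
  · intro H n d hn hd hdn W _ hW hne hrot hadd hmul hdim hdd
    exact H n d hn hd hdn W hW hne hrot hadd hmul hdim hdd
  · intro H n d hn hd hdn
    exact ecCell_of_gallinaro_of_nonsplit hG (H n d hn hd hdn)

/-- **In `ℂ³ × (ℂˣ)³` everything reduces to the cell `(3, 2)`** (granted Mantova–Masser 2024 Thm. 1.1):
EAC for all free rotund 3-folds `V ⊆ ℂ³ × (ℂˣ)³` holds iff it holds for those whose additive
projection is a surface — the literature's "simplest case of dimension 2 in `ℂ³ × ℂ*³`"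
(Mantova–Masser 2024 §1 p. 5), an OPEN statement used only inside the equivalence.
[cite: MantovaMasser2023, §1 Further remarks] -/
theorem forall_ecCell_three_iff (h : mantovaMasser2024_thm_1_1) : (∀ d, ECCell 3 d) ↔ ECCell 3 2 := by
  constructor
  · exact fun H => H 2
  · intro h32 d W hW hne hrot hadd hmul hdim hd
    have hdn : d ≤ 3 := le_of_addProjDim_eq hne hd
    interval_cases d
    · exact ecCell_zero_right (by norm_num) W hW hne hrot hadd hmul hdim hd
    · exact ecCell_one_right_of_mantovaMasser h 3 W hW hne hrot hadd hmul hdim hd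
    · exact h32 W hW hne hrot hadd hmul hdim hd
    · exact ecCell_self 3 W hW hne hrot hadd hmul hdim hd

/-- The first open rung is the whole `n = 3` slice of the open regime: the open-regime cells with
`n = 3` are exactly `ECCell 3 2`. [folklore] -/
theorem open_regime_three_iff : (∀ d : ℕ, 2 ≤ d → d + 1 ≤ 3 → ECCell 3 d) ↔ ECCell 3 2 := by
  constructor
  · exact fun H => H 2 le_rfl le_rfl
  · intro h32 d hd hd3
    obtain rfl : d = 2 := by omega
    exact h32

end Literature.ModelTheory.Zilber
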